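import Summits.BirchSwinnertonDyer.Rank1Residual.Additive.CensusX42HeightPinning
import Summits.BirchSwinnertonDyer.Rank1Residual.Additive.BranchPAdicGrossZagierUpperHalf
import HarnessLib

/-!
# Rescaling the `p`-adic height datum, III: on an ANOMALOUS unit row `Dh / p` is again a (B)-datum —
# the `∀ Dh` packaging of every "up to a `p`-adic unit" input is VACUOUS there
# (cell `b2b-bsdres`, census cell `bsd-formula-census`, seat `b2b-bsdres-census-ctyper1` =
# conjecture-typer 1, gen 9; prequels `CensusX42HeightRescaling.lean`, `CensusX42HeightPinning.lean`
# (gen 8, §3 "rider"), `CensusX42ForallErratum.lean` (gen 8, exact grade); sequel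
# `CensusX42ForallAnomalousWitness.lean`)

HONEST FRAMING (cell `b2b-bsdres`, run/shared/lean/b2b/bsd-rank1-residual/, verbatim in every
file): the goal of the cell is to DELETE the COMBINATION-SHAPED residual classes of the
Birch–Swinnerton-Dyer formula for ALL analytic-rank `≤ 1` elliptic curves over `ℚ` — "full BSD
formula for every rank `≤ 1` curve in class `C`" assembled STRICTLY from published theorems — so
that the rank-`≤ 1` remainder becomes exactly the CONSTRUCTION-SHAPED classes, which are TYPED
(missing-input `Prop`s), NOT attempted. This is not "finishing BSD". Census cell
(bsd-formula-census): research instrumentation; census output = EVIDENCE / conjecture items, never a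
Literature fact; labels / RESIDUAL-MAP marks UNCHANGED (O7-ord OPEN; X3♯ / X4♯ CONSTRUCTION-SHAPED);
nothing booked. Theorems only (no definition, no named fact); named facts enter as HYPOTHESES
(`hK` / `hWu`, `hGZK`, `hmod`, `hmodD`).

## What

Gen 8 (`CensusX42HeightPinning.lean` §3) recorded that the WINDOW-grade packaging
`∀ Dh, LeadingTermClauses W p Dh → (norm-pinning statement about Reg_p(E,Dh))` — n1011's
`hGZ : ∀ Dh, LeadingTermClauses → SchneiderConjecture Dh ∧ BranchPAdicGrossZagier[Odd]At W p Dh` and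
this seat's `hrel : ∀ Dh, LeadingTermClauses → CensusX42.ValRelationAt W p Dh` — asserts, beyond the
relation for ONE (B)-datum, that `p · Dh` is never a (B)-datum when `Dh` is, and called this an
"`ℓ_p(E)`-shaped rider on the ANOMALOUS (G-ord) rows". This file computes the rider: on an anomalous
UNIT row it is FALSE, so the packaging hypothesis is unsatisfiable there.

* WHY. The tree transcribes Delbourgo 2002 Thm. (B) WEAKER THAN PRINT
  (`Literature/…/Delbourgo2002/PAdicBSDLeadingTerm.lean`, flag `Del02-ThmB-ellp-anomalous`): the
  factor `ℓ_p(E)` is `∃ ℓ ∣ p²` INSIDE the quantifier over `(κ, γ, D, fE)`, pinned to `1` only under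
  `ReductionNonAnomalous W p`. Off the anomalous rows the (B)-data of a row therefore form ONE class
  `{u · Dh}` in norm and the packaging is consistent (every IMC-version / iff theorem of the cell
  carries `hna : ReductionNonAnomalous W p` or lives on (M), where `hna` is automatic). ON an
  anomalous row nothing pins `ℓ`, and:
* §1 (`Λ`-algebra, cell-agnostic) `CensusX42.valuation_le_of_identity_of_iota_eq`: additive-p2's
  Kato-type inequality `ord_p #Ш[p^∞] + ord_p Reg_p + ord_p ∏c + ord_p ℓ ≤ ord_p [T¹](ϖ·B) + 1 +
  2·ord_p #T` for the `ℓ` of a GIVEN instance of clause 3 (not an existential one) —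
  `GordRankOneKatoUpperBound.schneider_and_padicVal_le_rankOne_of_iota_eq` re-run on the identity in hand.
* §2 `CensusX42.exists_identity_dvd_prime_of_iota_eq_of_pgz_of_shaAn_unit`: at a tuple `(κ, γ, D, fE)`
  carrying Kato's `ι g = C(u·ϖ)·B`, a (B)-datum `Dh` with the rider and the `p`-adic Gross–Zagier
  identity for the same `(ϖ, B)` (`L'(E,1) = q·Ω·Reg_∞`, `ϖ·[T¹]B·log_p γ = u'·q·Reg_p(E,Dh)`) on a
  UNIT row (`ord_p #Ш_an = 0`) has its clause-3 factor `ℓ = 1 ∣ p` AT THAT TUPLE (p01's CORE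
  arithmetic `ord_p #Ш + ord_p ℓ ≤ ord_p #Ш_an`, `BranchPAdicGrossZagierUpperHalf.lean` §1, with §1).
* §3 `CensusX42.leadingTermClauses_of_pairing_eq_inv_prime_mul_of_anomalous`: on an ANOMALOUS row
  (`¬ ReductionNonAnomalous W p`), rank `1`, a (B)-datum `Dh` whose clause-3 factor divides `p` at
  EVERY tuple makes `Dh' = p⁻¹ · Dh` a (B)-datum (`ℓ' = p·ℓ ∣ p²`; the pin `→ ℓ' = 1` is vacuous).
The sequel `CensusX42ForallAnomalousWitness.lean` supplies Kato's / Wuthrich's brick at EVERY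
cyclotomic tuple on the (G-ord, `e = 2`) classes (so §2 + §3 make `p⁻¹ · Dh` a (B)-datum there), turns
this into the `¬ ∀ Dh, …` witnesses, and lists the affected theorems. On which reading of `ℓ_p(E)` is
right (J. Number Theory 95 (2002) p. 70 versus the cell's reading note) NOTHING here depends: the
vacuity is a property of the TRANSCRIPTION `∃ ℓ ∣ p²`, i.e. of the tree's hypothesis shape, not of any
curve. Nothing about any curve is asserted; nothing booked; no mark / label moved.

References: D. Delbourgo, J. Number Theory 95 (2002) p. 39 (`ℓ_p(E)`), Thm. (B) (p. 40), pp. 69–70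
[Delbourgo2002]; K. Kato, Astérisque 295 (2004) Thm. 17.4 (3) [Kato2004Asterisque]; C. Wuthrich,
Doc. Math. 19 (2014) Thm. 16, Lemma 20 [Wuthrich2014]; B. Mazur, J. Tate, J. Teitelbaum, Invent.
Math. 84 (1986) §I.13–I.14, §II.4 [MazurTateTeitelbaum1986Invent]; W. Stein, C. Wuthrich, Math. Comp.
82 (2013) §4 (shape of the Kato-type bound) [SteinWuthrich2013]; R. L. Miller, LMS J. Comput. Math. 14
(2011) Def. 1.1 [Miller2011LMS].
-/

set_option autoImplicit false

noncomputable section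

open scoped Classical MatrixGroups ModularForm NumberField

open CongruenceSubgroup WeierstrassCurve NumberField Literature.NumberTheory.EllipticCurves
  Literature.NumberTheory.EllipticCurves.ModularForms
  Literature.NumberTheory.EllipticCurves.Rank1Residual
  Literature.NumberTheory.EllipticCurves.Rank1Residual.Typed
  Literature.NumberTheory.EllipticCurves.Delbourgo2002
  Literature.NumberTheory.GaloisRepresentations
  Literature.Barriers.BirchSwinnertonDyer
  IsDedekindDomain

namespace Summit.BirchSwinnertonDyer.Rank1Residual.Additive

namespace CensusX42

variable {W : WeierstrassCurve ℚ} {p : ℕ} [hp : Fact p.Prime]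

/-! ### §1 The Kato-type inequality for the `ℓ` of a GIVEN instance of clause 3 -/

/-- **Kato-type inequality for a GIVEN leading-term identity** (rank one). Let `Dh` be a (B)-datum,
`(κ, γ, D, fE)` a cyclotomic tuple with `X` torsion, `g ∈ char_Λ X` with Kato's `ι g = C(u·ϖ)·B` and
`[T¹](ϖ·B) ≠ 0`, and suppose the clause-3 identity holds at this tuple with the unit `u'` and the
natural number `ℓ ≠ 0`: `[T¹] fE · log_p γ · #T² = u'·ℓ·(#Ш[p^∞]·Reg_p(E,Dh)·∏c)`. Then
`ord_p #Ш[p^∞] + ord_p Reg_p + ord_p ∏c + ord_p ℓ ≤ ord_p [T¹](ϖ·B) + 1 + 2·ord_p #E(ℚ)_tors`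
(`g = fE·h`, `fE(0) = 0` by clause 1, `[T¹] g = [T¹] fE · h(0)`, `ord_p h(0) ≥ 0`). This is
additive-p2's `schneider_and_padicVal_le_rankOne_of_iota_eq` for the `ℓ` IN HAND rather than an
existential one. [cite: Delbourgo2002, Theorem (B) (p. 40)] [cite: SteinWuthrich2013, §4 (shape)] -/
theorem valuation_le_of_identity_of_iota_eq [W.IsElliptic] (hp2 : p ≠ 2)
    (hr1 : W.mordellWeilRank = 1) {Dh : PAdicHeightData W p} (hB : LeadingTermClauses W p Dh)
    {κ : ZpExtension ℚ p} {γ : Field.absoluteGaloisGroup ℚ}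
    (hκ : κ.IsCyclotomic) (hγ : κ.IsTopGenerator γ) (hγ' : IsCyclotomicVariable p γ)
    (D : W.SelmerDualData κ γ) [Module.Finite (IwasawaAlgebra p) D.X] (hX : D.IsTorsion)
    {fE g : IwasawaAlgebra p} (hchar : D.charIdeal = Ideal.span {fE}) (hg : g ∈ D.charIdeal)
    {u : ℤ_[p]ˣ} {ϖ : ℚ} {B : PowerSeries ℚ_[p]}
    (hι : iwasawaToPowerSeries p g =
      PowerSeries.C (((u : ℤ_[p]) : ℚ_[p]) * (ϖ : ℚ_[p])) * B)
    (hne : PowerSeries.coeff 1 (PowerSeries.C (ϖ : ℚ_[p]) * B) ≠ 0)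
    [Finite (AddCommGroup.primaryComponent W.sha p)] (hS : SchneiderConjecture Dh)
    {u' : ℤ_[p]ˣ} {ℓ : ℕ} (hℓ0 : ℓ ≠ 0)
    (heq : ((PowerSeries.coeff 1 fE : ℤ_[p]) : ℚ_[p]) * padicLog p (cyclotomicGenerator p) *
        (W.torsionOrder : ℚ_[p]) ^ 2 =
      ((u' : ℤ_[p]) : ℚ_[p]) * (ℓ : ℚ_[p]) *
        ((Nat.card (AddCommGroup.primaryComponent W.sha p) : ℚ_[p]) * padicRegulator Dh *
          (W.tamagawaProduct : ℚ_[p]))) :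
    (padicValNat p (Nat.card (AddCommGroup.primaryComponent W.sha p)) : ℤ) +
        (padicRegulator Dh).valuation + padicValNat p W.tamagawaProduct + padicValNat p ℓ ≤
      (PowerSeries.coeff 1 (PowerSeries.C (ϖ : ℚ_[p]) * B)).valuation + 1 +
        2 * padicValNat p W.torsionOrder := by
  have hpP : p.Prime := hp.out
  -- `g = fE · h`, `fE(0) = 0`
  have hgmem : g ∈ Ideal.span {fE} := by rw [← hchar]; exact hg
  obtain ⟨h, hgh⟩ := Ideal.mem_span_singleton'.mp hgmem
  have hle : (W.mordellWeilRank : ℕ∞) ≤ fE.order := (hB κ γ hκ hγ hγ' D hX fE hchar).1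
  have hf0 : PowerSeries.constantCoeff fE = 0 := by
    rw [← PowerSeries.coeff_zero_eq_constantCoeff]
    apply PowerSeries.coeff_of_lt_order
    refine lt_of_lt_of_le ?_ hle
    rw [hr1]
    exact_mod_cast Nat.zero_lt_one
  have hg1 : PowerSeries.coeff 1 g = PowerSeries.coeff 1 fE * PowerSeries.constantCoeff h := by
    rw [← hgh, mul_comm h fE]
    exact coeff_one_mul_eq_mul_constantCoeff hf0
  have hcoe := coe_coeff_one_eq_of_iota_eq hι
  have hu0 : ((u : ℤ_[p]) : ℚ_[p]) ≠ 0 := coe_units_ne_zero p u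
  have hg1Q : ((PowerSeries.coeff 1 g : ℤ_[p]) : ℚ_[p]) ≠ 0 := by
    rw [hcoe]; exact mul_ne_zero hu0 hne
  have hg1ne : PowerSeries.coeff 1 g ≠ 0 := fun h0 ↦ hg1Q (by rw [h0]; rfl)
  have hfE1 : PowerSeries.coeff 1 fE ≠ 0 := fun h0 ↦ hg1ne (by rw [hg1, h0, zero_mul])
  have hh0 : PowerSeries.constantCoeff h ≠ 0 := fun h0 ↦ hg1ne (by rw [hg1, h0, mul_zero])
  -- valuations
  obtain ⟨w, hw⟩ := exists_unit_padicLog_cyclotomicGenerator (p := p) hp2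
  have hpQ : (p : ℚ_[p]) ≠ 0 := by exact_mod_cast hpP.ne_zero
  have hlog0 : padicLog p (cyclotomicGenerator p : ℚ_[p]) ≠ 0 := by
    rw [hw]; exact mul_ne_zero hpQ (coe_units_ne_zero p w)
  have hlogv : (padicLog p (cyclotomicGenerator p : ℚ_[p])).valuation = 1 := by
    rw [hw, Padic.valuation_mul hpQ (coe_units_ne_zero p w), Padic.valuation_p,
      valuation_coe_units_eq_zero, add_zero]
  have hT0 : W.torsionOrder ≠ 0 := (W.torsionOrder_pos_holds).ne'
  have hTQ : (W.torsionOrder : ℚ_[p]) ≠ 0 := by exact_mod_cast hT0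
  have hu'0 : ((u' : ℤ_[p]) : ℚ_[p]) ≠ 0 := coe_units_ne_zero p u'
  have hℓQ : (ℓ : ℚ_[p]) ≠ 0 := by exact_mod_cast hℓ0
  have hShp0 : (Nat.card (AddCommGroup.primaryComponent W.sha p) : ℚ_[p]) ≠ 0 := by
    exact_mod_cast Nat.card_pos.ne'
  have hRg0 : padicRegulator Dh ≠ 0 := hS
  have hCc0 : (W.tamagawaProduct : ℚ_[p]) ≠ 0 := by
    exact_mod_cast (W.tamagawaProduct_pos_holds : 0 < W.tamagawaProduct).ne'
  have hfE1Q : ((PowerSeries.coeff 1 fE : ℤ_[p]) : ℚ_[p]) ≠ 0 := fun h0 ↦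
    hfE1 (PadicInt.coe_eq_zero.mp h0)
  have hh0Q : ((PowerSeries.constantCoeff h : ℤ_[p]) : ℚ_[p]) ≠ 0 := fun h0 ↦
    hh0 (PadicInt.coe_eq_zero.mp h0)
  have hL : (((PowerSeries.coeff 1 fE : ℤ_[p]) : ℚ_[p]) *
        padicLog p (cyclotomicGenerator p) * (W.torsionOrder : ℚ_[p]) ^ 2).valuation =
      ((PowerSeries.coeff 1 fE : ℤ_[p]) : ℚ_[p]).valuation + 1 +
        2 * (padicValNat p W.torsionOrder : ℤ) := by
    rw [Padic.valuation_mul (mul_ne_zero hfE1Q hlog0) (pow_ne_zero 2 hTQ),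
      Padic.valuation_mul hfE1Q hlog0, Padic.valuation_pow, hlogv, Padic.valuation_natCast]
    push_cast
    ring
  have hR : (((u' : ℤ_[p]) : ℚ_[p]) * (ℓ : ℚ_[p]) *
        ((Nat.card (AddCommGroup.primaryComponent W.sha p) : ℚ_[p]) * padicRegulator Dh *
          (W.tamagawaProduct : ℚ_[p]))).valuation =
      (padicValNat p ℓ : ℤ) +
        ((padicValNat p (Nat.card (AddCommGroup.primaryComponent W.sha p)) : ℤ) +
          (padicRegulator Dh).valuation + padicValNat p W.tamagawaProduct) := by
    rw [Padic.valuation_mul (mul_ne_zero hu'0 hℓQ) (mul_ne_zero (mul_ne_zero hShp0 hRg0) hCc0),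
      Padic.valuation_mul hu'0 hℓQ, valuation_coe_units_eq_zero, zero_add, Padic.valuation_natCast,
      Padic.valuation_mul (mul_ne_zero hShp0 hRg0) hCc0, Padic.valuation_mul hShp0 hRg0,
      Padic.valuation_natCast, Padic.valuation_natCast]
  have hval := congrArg Padic.valuation heq
  rw [hL, hR] at hval
  -- `ord [T¹] fE ≤ ord [T¹] g = ord [T¹](ϖ·B)`
  have hle1 : ((PowerSeries.coeff 1 fE : ℤ_[p]) : ℚ_[p]).valuation ≤
      (PowerSeries.coeff 1 (PowerSeries.C (ϖ : ℚ_[p]) * B)).valuation := by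
    have hgv : ((PowerSeries.coeff 1 g : ℤ_[p]) : ℚ_[p]).valuation =
        (PowerSeries.coeff 1 (PowerSeries.C (ϖ : ℚ_[p]) * B)).valuation := by
      rw [hcoe, Padic.valuation_mul hu0 hne, valuation_coe_units_eq_zero, zero_add]
    rw [← hgv, hg1, PadicInt.coe_mul, Padic.valuation_mul hfE1Q hh0Q]
    have := PadicInt.valuation_coe_nonneg (x := PowerSeries.constantCoeff h)
    linarith
  linarith

/-! ### §2 On a UNIT row the clause-3 factor is `ℓ = 1` at every Kato tuple -/

/-- **Unit row ⟹ `ℓ = 1 ∣ p` at the tuple** (rank one, cell-agnostic). At a cyclotomic tuple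
`(κ, γ, D, fE)` carrying Kato's `ι g = C(u·ϖ)·B` (`g ∈ char_Λ X`), a (B)-datum `Dh` with the rider,
the `p`-adic Gross–Zagier identity for the SAME `(ϖ, B)` (`L'(E,1) = q·Ω_E·Reg_∞`,
`ϖ·[T¹]B·log_p γ = u'·q·Reg_p(E,Dh)`) and `ord_p #Ш_an(E) = 0`: clause 3 of Theorem (B) holds at this
tuple with a factor `ℓ` DIVIDING `p` (in fact `ℓ = 1`: p01's CORE `ord_p #Ш + ord_p ℓ ≤ ord_p #Ш_an`
run with §1 on the identity in hand). [cite: Delbourgo2002, Theorem (B) (p. 40) and p. 39 (ℓ_p(E))]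
[cite: Kato2004Asterisque, Thm. 17.4 (3) (p. 273)] [cite: Miller2011LMS, Def. 1.1] -/
theorem exists_identity_dvd_prime_of_iota_eq_of_pgz_of_shaAn_unit [W.IsElliptic] [W.IsGloballyMinimal]
    (hp2 : p ≠ 2) (hGZK : rank_eq_analyticRank_of_analyticRank_le_one) (hmod : hasEntireLFunction_rat)
    (hr : W.analyticRank = 1) {Dh : PAdicHeightData W p} (hB : LeadingTermClauses W p Dh)
    (hS : SchneiderConjecture Dh)
    {κ : ZpExtension ℚ p} {γ : Field.absoluteGaloisGroup ℚ}
    (hκ : κ.IsCyclotomic) (hγ : κ.IsTopGenerator γ) (hγ' : IsCyclotomicVariable p γ)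
    (D : W.SelmerDualData κ γ) [Module.Finite (IwasawaAlgebra p) D.X] (hX : D.IsTorsion)
    {fE g : IwasawaAlgebra p} (hchar : D.charIdeal = Ideal.span {fE}) (hg : g ∈ D.charIdeal)
    {u : ℤ_[p]ˣ} {ϖ : ℚ} {B : PowerSeries ℚ_[p]}
    (hι : iwasawaToPowerSeries p g =
      PowerSeries.C (((u : ℤ_[p]) : ℚ_[p]) * (ϖ : ℚ_[p])) * B)
    {u' : ℤ_[p]ˣ} {q : ℚ}
    (hlead : W.leadingLCoeff = (q : ℂ) * (W.realPeriodRat : ℂ) * (W.regulator : ℂ))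
    (hpgz : ((ϖ : ℚ) : ℚ_[p]) * PowerSeries.coeff W.mordellWeilRank B *
        padicLog p (cyclotomicGenerator p) ^ W.mordellWeilRank =
      ((u' : ℤ_[p]) : ℚ_[p]) * (q : ℚ_[p]) * padicRegulator Dh)
    {s : ℚ} (hs : shaAn W = (s : ℂ)) (hv : padicValRat p s = 0) :
    Finite (AddCommGroup.primaryComponent W.sha p) ∧
    ∃ (u₀ : ℤ_[p]ˣ) (ℓ : ℕ), ℓ ∣ p ∧
      ((PowerSeries.coeff W.mordellWeilRank fE : ℤ_[p]) : ℚ_[p]) *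
          padicLog p (cyclotomicGenerator p) ^ W.mordellWeilRank * (W.torsionOrder : ℚ_[p]) ^ 2 =
        ((u₀ : ℤ_[p]) : ℚ_[p]) * (ℓ : ℚ_[p]) *
          ((Nat.card (AddCommGroup.primaryComponent W.sha p) : ℚ_[p]) * padicRegulator Dh *
            W.tamagawaProduct) := by
  have hpP : p.Prime := hp.out
  obtain ⟨hmw, hfinSha⟩ := hGZK W (by rw [hr])
  have hr1 : W.mordellWeilRank = 1 := by rw [hmw, hr]
  haveI : Finite W.sha := hfinSha
  have hfin : Finite (AddCommGroup.primaryComponent W.sha p) := inferInstance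
  obtain ⟨u₀, ℓ, hℓp, -, heq⟩ := (hB κ γ hκ hγ hγ' D hX fE hchar).2.2 hS hfin
  refine ⟨hfin, u₀, ℓ, ?_, heq⟩
  -- the identity in rank-one form
  have heq1 := heq
  rw [hr1, pow_one] at heq1 hpgz
  -- `q ≠ 0` (modularity), hence `[T¹](ϖ·B) ≠ 0` from the typed identity and the rider
  have hL0 : W.leadingLCoeff ≠ 0 := W.leadingLCoeff_ne_zero_holds (hmod W)
  have hq0 : q ≠ 0 := by
    rintro rfl
    apply hL0
    rw [hlead]
    simp
  have hqQ : ((q : ℚ) : ℚ_[p]) ≠ 0 := by exact_mod_cast hq0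
  have hu'0 : ((u' : ℤ_[p]) : ℚ_[p]) ≠ 0 := coe_units_ne_zero p u'
  have hRg0 : padicRegulator Dh ≠ 0 := hS
  obtain ⟨w, hw⟩ := exists_unit_padicLog_cyclotomicGenerator (p := p) hp2
  have hpQ : (p : ℚ_[p]) ≠ 0 := by exact_mod_cast hpP.ne_zero
  have hlog0 : padicLog p (cyclotomicGenerator p : ℚ_[p]) ≠ 0 := by
    rw [hw]; exact mul_ne_zero hpQ (coe_units_ne_zero p w)
  have hlogv : (padicLog p (cyclotomicGenerator p : ℚ_[p])).valuation = 1 := by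
    rw [hw, Padic.valuation_mul hpQ (coe_units_ne_zero p w), Padic.valuation_p,
      valuation_coe_units_eq_zero, add_zero]
  have hc1 : PowerSeries.coeff 1 (PowerSeries.C (ϖ : ℚ_[p]) * B) =
      ((ϖ : ℚ) : ℚ_[p]) * PowerSeries.coeff 1 B := by
    rw [PowerSeries.coeff_C_mul]
  have hprod0 : ((ϖ : ℚ) : ℚ_[p]) * PowerSeries.coeff 1 B ≠ 0 := by
    intro hz
    rw [hz, zero_mul] at hpgz
    exact mul_ne_zero (mul_ne_zero hu'0 hqQ) hRg0 hpgz.symm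
  have hne : PowerSeries.coeff 1 (PowerSeries.C (ϖ : ℚ_[p]) * B) ≠ 0 := by rw [hc1]; exact hprod0
  have hℓ0 : ℓ ≠ 0 := by
    rintro rfl
    exact hpP.ne_zero (pow_eq_zero_iff (n := 2) (by norm_num) |>.mp (zero_dvd_iff.mp hℓp))
  -- §1 on the identity in hand
  have hle := valuation_le_of_identity_of_iota_eq hp2 hr1 hB hκ hγ hγ' D hX hchar hg hι hne hS
    hℓ0 heq1
  rw [hc1] at hle
  -- the valuation of `[T¹](ϖB)` from the typed identity
  have hval := congrArg Padic.valuation hpgz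
  rw [Padic.valuation_mul hprod0 hlog0, hlogv, Padic.valuation_mul (mul_ne_zero hu'0 hqQ) hRg0,
    Padic.valuation_mul hu'0 hqQ, valuation_coe_units_eq_zero, zero_add, Padic.valuation_ratCast] at hval
  -- the unit row: `ord_p (q·#T²/∏c) = 0`
  have hT0 : W.torsionOrder ≠ 0 := (W.torsionOrder_pos_holds).ne'
  have hTq : (W.torsionOrder : ℚ) ≠ 0 := by exact_mod_cast hT0
  have hPq : (W.tamagawaProduct : ℚ) ≠ 0 := by
    exact_mod_cast (W.tamagawaProduct_pos_holds : 0 < W.tamagawaProduct).ne'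
  have hs' : s = q * (W.torsionOrder : ℚ) ^ 2 / (W.tamagawaProduct : ℚ) := by
    have h := hs.symm.trans (shaAn_eq_of_leadingLCoeff_eq W hlead)
    exact_mod_cast h
  rw [hs', padicValRat.div (mul_ne_zero hq0 (pow_ne_zero 2 hTq)) hPq,
    padicValRat.mul hq0 (pow_ne_zero 2 hTq), padicValRat.pow, padicValRat.of_nat,
    padicValRat.of_nat] at hv
  -- so `ord_p ℓ + ord_p #Ш[p^∞] ≤ 0`, i.e. `ord_p ℓ = 0`, i.e. `ℓ = 1`
  have hSh0 : (0 : ℤ) ≤ padicValNat p (Nat.card (AddCommGroup.primaryComponent W.sha p)) := by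
    exact_mod_cast Nat.zero_le _
  have hℓv : padicValNat p ℓ = 0 := by
    have h2 : (0 : ℤ) ≤ padicValNat p ℓ := by exact_mod_cast Nat.zero_le _
    have h1 : (padicValNat p ℓ : ℤ) ≤ 0 := by
      push_cast at hle hval hv hSh0 ⊢
      linarith
    exact_mod_cast le_antisymm h1 h2
  obtain ⟨k, -, rfl⟩ := (Nat.dvd_prime_pow hpP).mp hℓp
  rw [padicValNat.prime_pow] at hℓv
  rw [hℓv, pow_zero]
  exact one_dvd p

/-! ### §3 On an ANOMALOUS row `p⁻¹ · Dh` is again a (B)-datum -/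

/-- **`p⁻¹ · Dh` is a (B)-datum on an ANOMALOUS row** (rank one). If `¬ ReductionNonAnomalous W p`
(the pin `ℓ = 1` of the transcribed Theorem (B) is vacuous), `Dh` satisfies `LeadingTermClauses W p Dh`
and, at EVERY cyclotomic tuple, clause 3 for `Dh` holds with a factor `ℓ ∣ p`, then the datum `Dh'`
with `⟨P,Q⟩_{Dh'} = p⁻¹ · ⟨P,Q⟩_{Dh}` satisfies `LeadingTermClauses W p Dh'` — with the factor
`p · ℓ ∣ p²` (`Reg_p(E,Dh') = p⁻¹ · Reg_p(E,Dh)`; clauses 1–2 are blind to the scale). So on such a row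
the (B)-data do NOT form one unit class in norm. [cite: Delbourgo2002, Theorem (B) (p. 40) and p. 39 (ℓ_p(E))]
[cite: MazurTateTeitelbaum1986Invent, §II.4] -/
theorem leadingTermClauses_of_pairing_eq_inv_prime_mul_of_anomalous [W.IsElliptic]
    (hanom : ¬ ReductionNonAnomalous W p) (hr1 : W.mordellWeilRank = 1)
    {Dh Dh' : PAdicHeightData W p} (hB : LeadingTermClauses W p Dh)
    (hc : ∀ P Q, Dh'.pairing P Q = (p : ℚ_[p])⁻¹ * Dh.pairing P Q)
    (hℓ : ∀ (κ : ZpExtension ℚ p) (γ : Field.absoluteGaloisGroup ℚ),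
      κ.IsCyclotomic → κ.IsTopGenerator γ → IsCyclotomicVariable p γ →
      ∀ (D : W.SelmerDualData κ γ) [Module.Finite (IwasawaAlgebra p) D.X], D.IsTorsion →
      ∀ (fE : IwasawaAlgebra p), D.charIdeal = Ideal.span {fE} →
        SchneiderConjecture Dh → Finite (AddCommGroup.primaryComponent W.sha p) →
        ∃ (u₀ : ℤ_[p]ˣ) (ℓ : ℕ), ℓ ∣ p ∧
          ((PowerSeries.coeff W.mordellWeilRank fE : ℤ_[p]) : ℚ_[p]) *
              padicLog p (cyclotomicGenerator p) ^ W.mordellWeilRank * (W.torsionOrder : ℚ_[p]) ^ 2 =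
            ((u₀ : ℤ_[p]) : ℚ_[p]) * (ℓ : ℚ_[p]) *
              ((Nat.card (AddCommGroup.primaryComponent W.sha p) : ℚ_[p]) * padicRegulator Dh *
                W.tamagawaProduct)) :
    LeadingTermClauses W p Dh' := by
  have hpQ : (p : ℚ_[p]) ≠ 0 := by exact_mod_cast hp.out.ne_zero
  have hc0 : (p : ℚ_[p])⁻¹ ≠ 0 := inv_ne_zero hpQ
  intro κ γ hκ hγ hγ' D _ hX fE hf
  obtain ⟨h1, h2, -⟩ := hB κ γ hκ hγ hγ' D hX fE hf
  refine ⟨h1, ?_, ?_⟩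
  · rw [schneiderConjecture_iff_of_pairing_eq_mul hc0 hc]
    exact h2
  · intro hS' hfin
    have hS : SchneiderConjecture Dh := (schneiderConjecture_iff_of_pairing_eq_mul hc0 hc).mp hS'
    obtain ⟨u₀, ℓ, hℓp, heq⟩ := hℓ κ γ hκ hγ hγ' D hX fE hf hS hfin
    refine ⟨u₀, p * ℓ, ?_, fun hna ↦ absurd hna hanom, ?_⟩
    · rw [pow_two]
      exact Nat.mul_dvd_mul_left p hℓp
    · rw [heq, padicRegulator_eq_of_pairing_eq_mul hc, hr1, pow_one, Nat.cast_mul]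
      have hpp : (p : ℚ_[p]) * (p : ℚ_[p])⁻¹ = 1 := mul_inv_cancel₀ hpQ
      linear_combination
        (-(((u₀ : ℤ_[p]) : ℚ_[p]) * (ℓ : ℚ_[p]) *
          ((Nat.card (AddCommGroup.primaryComponent W.sha p) : ℚ_[p]) * padicRegulator Dh *
            (W.tamagawaProduct : ℚ_[p])))) * hpp

end CensusX42

end Summit.BirchSwinnertonDyer.Rank1Residual.Additive

end
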